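import Mathlib
import HarnessLib
import Literature.Analysis.FluidPDE.SelfSimilar
import Literature.Analysis.FluidPDE.LocalTypeI
import Literature.Analysis.FluidPDE.VectorCalculus
import Literature.Analysis.FluidPDE.ClassicalSolution
import Literature.Analysis.FluidPDE.TypeIAncientMild
import Literature.Analysis.FluidPDE.TypeIAncientMildClassical
import Literature.Analysis.FluidPDE.AncientMildCurlCompactness
import Literature.Analysis.FluidPDE.EnstrophySplitting
import Literature.Analysis.FluidPDE.SwirlTransportProofs
import Literature.Analysis.UnboundedOperators.HeatKernel
import Summits.NavierStokesRegularity.NavierStokesRegularity.Theorems.LocalSineTubeDoorProfileAlignedWindowRigidityAncient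
import Summits.NavierStokesRegularity.NavierStokesRegularity.Theorems.PoloidalWindowDoorPoloidalWindowRigidityWindow
import Summits.NavierStokesRegularity.NavierStokesRegularity.Theorems.PoloidalWindowDoorPoloidalWindowRigidityClassRate
import Summits.NavierStokesRegularity.NavierStokesRegularity.Theorems.PoloidalWindowDoorPoloidalWindowRigidityOneSlice
import Summits.NavierStokesRegularity.NavierStokesRegularity.Theorems.PoloidalWindowDoorPoloidalWindowRigidityFlat
import Summits.NavierStokesRegularity.NavierStokesRegularity.Theorems.PoloidalWindowDoorPoloidalWindowRigidityScrewKinematics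
import Summits.NavierStokesRegularity.NavierStokesRegularity.Theorems.PoloidalWindowDoorPoloidalWindowRigidityRotatedLeray
import Summits.NavierStokesRegularity.NavierStokesRegularity.Theorems.PoloidalWindowDoorPoloidalWindowRigidityRotatedLerayLiouville

/-!
# Route `PoloidalWindowDoor`, crux `PoloidalWindowRigidity` (K2, stmt-NavierStokesRegularity-19708) —
# THE VERTICAL-AXIS ROTATING SELF-SIMILAR (RSS) STRATUM, SLOW ROTATION: EMPTY

Cell ns-regularity-ideate, seat ns-poloidal-K2-p2 (stub-worker; `--supports` the crux, `--as helper`).  The one-parameter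
symmetry strata of the residue left open after `…Similarity` (p463285) is rotating self-similarity about a VERTICAL axis
(Perelman's «RSS» ansatz; Bradshaw–Tsai CPDE 42 (2017) OP 5.2; Pineau–Vicol arXiv:2607.09619 Conj. 1.1): in the units of
the route's class (`y = x/√(−t)`), invariance under the spiral subgroup

  `e^r v(e^{2r} s, e^r R_{κr} y) = R_{κr} v(s, y)`   for all `r ∈ ℝ`, `s < 0`, `y`     (`κ = 0`: scale invariance).

* `profileEq_of_rss` — differentiating the invariance at `r = 0` on the slice `s = −1` (joint smoothness of the
  classical solution the class provides, `IsTypeIAncientMild.exists_isClassicalNSSolutionOn_Ioo`) gives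
  `∂ₜv(−1) = ½v + ½Dv[y] + (κ/2)(Dv[Jy] − Jv)`, and with the momentum equation at `t = −1` the slice
  `U = v(−1)`, `P = p(−1)` solves the ROTATED LERAY SYSTEM of `…RotatedLeray` with `ν = 1`, `a = ½`, `β = κ/2`;
* `pressure_growth` — `|P(y)| ≤ C'(1 + |y|)²` from that system and the class bounds on `DU`, `ΔU`
  (`…ClassRate.exists_fderiv_rate_of_class`; KNSS (4.10) `exists_iteratedFDeriv_bound_of_bounded_oseenMild` on a
  time-shifted window; `norm_laplacian_le_three_mul_norm_iteratedFDeriv_two`);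
* **`eq_zero_of_spiralSelfSimilar_vertical`** — class + POLOIDAL + spiral invariance with `|κ| < 1` (i.e. `|β| < a`)
  ⇒ `v ≡ 0`: `…RotatedLerayLiouville.rotatedLeray_const_of_poloidal` makes `v(−1)` constant, a constant slice is
  translation-invariant, `…OneSlice.eq_zero_of_translate_eq_slice`; `nonflatLiouville_of_spiralSelfSimilar_vertical`.

So the residue of K2 may assume «not RSS about a vertical axis with |rate| < 1» (class units); `|κ| ≥ 1` awaits Tsai's
Lemma 5.1 with tangential drift (see `…RotatedLeray`).  Other centres `c`: `…Axisymmetric.class_translate` first.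

WHAT THIS IS NOT: not a claim about Navier–Stokes regularity and not Perelman's problem for general profiles — its
POLOIDAL, slowly rotating case inside the route's Type-I class (bears_on LADDER-NS N0, rung N0-LocalTubeDoorPoloidal).
-/

noncomputable section

-- the summit and its single sub-problem share the name (CONVENTIONS §1), as in every Theorems file
set_option linter.dupNamespace false

namespace Summit.NavierStokesRegularity.NavierStokesRegularity.Theorems.PoloidalWindowDoorPoloidalWindowRigiditySpiralSelfSimilar

open MeasureTheory Set Function Filter Topology TopologicalSpace Metric InnerProductSpace
open scoped RealInnerProductSpace InnerProductSpace Laplacian ContDiff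
open Literature.Analysis Literature.Analysis.FluidPDE
open Summit.NavierStokesRegularity.NavierStokesRegularity.Theorems.LocalSineTubeDoorProfileAlignedWindowRigidityAncient
open Summit.NavierStokesRegularity.NavierStokesRegularity.Theorems.PoloidalWindowDoorPoloidalWindowRigidityWindow
open Summit.NavierStokesRegularity.NavierStokesRegularity.Theorems.PoloidalWindowDoorPoloidalWindowRigidityClassRate
open Summit.NavierStokesRegularity.NavierStokesRegularity.Theorems.PoloidalWindowDoorPoloidalWindowRigidityOneSlice
open Summit.NavierStokesRegularity.NavierStokesRegularity.Theorems.PoloidalWindowDoorPoloidalWindowRigidityScrewKinematics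
open Summit.NavierStokesRegularity.NavierStokesRegularity.Theorems.PoloidalWindowDoorPoloidalWindowRigidityRotatedLeray
open Summit.NavierStokesRegularity.NavierStokesRegularity.Theorems.PoloidalWindowDoorPoloidalWindowRigidityRotatedLerayLiouville

variable {C : ℝ} {v : ℝ → EuclideanSpace ℝ (Fin 3) → EuclideanSpace ℝ (Fin 3)}

/-! ### class bounds on the slice `t = −1` -/

/-- **A uniform bound on `Δv(−1)`** for a profile of the class (KNSS (4.10) on the time-shifted window). -/
theorem exists_laplacian_bound (hrate : HasTypeITimeDecay C v)
    (hcont : ContinuousOn (uncurry v) (Iio (0 : ℝ) ×ˢ univ))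
    (hmild : ∀ s t : ℝ, s < t → t < 0 → ∀ x,
      v t x = UnboundedOperators.heatExtension (v s) (t - s) x - oseenDuhamel 1 s v v t x)
    (hdiv : ∀ t < 0, VectorCalculus.IsDivFree (v t)) :
    ∃ K : ℝ, ∀ y, ‖(Δ (v (-1))) y‖ ≤ K := by
  have hbdd := bdd_of_hasTypeITimeDecay hrate
  -- the time-shifted field `w τ = v (τ − ½)`, globally bounded on `(−∞, 0)`
  obtain ⟨hc', ⟨M, hM⟩, hm'⟩ := shift hcont hbdd hmild (show (0 : ℝ) < 1 / 2 by norm_num)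
  set w : ℝ → EuclideanSpace ℝ (Fin 3) → EuclideanSpace ℝ (Fin 3) := fun τ => v (τ + -(1 / 2)) with hw
  obtain ⟨K, hK⟩ := exists_iteratedFDeriv_bound_of_bounded_oseenMild M 2
  have hcw : ContinuousOn (uncurry w) (Ioo (-3 : ℝ) 0 ×ˢ univ) := hc'.mono (prod_mono Ioo_subset_Iio_self Subset.rfl)
  have hdivw : ∀ t ∈ Ioo (-3 : ℝ) 0, IsWeaklyDivFree (w t) := by
    intro t ht
    have ht' : t + -(1 / 2) < 0 := by linarith [ht.2]
    have hC1 : ContDiff ℝ 1 (w t) := (analyticOnNhd_slice hcont hbdd hmild ht').contDiff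
    exact VectorCalculus.IsDivFree.isWeaklyDivFree_holds (hdiv _ ht') hC1
  have hmw : ∀ s t : ℝ, (-3 : ℝ) < s → s < t → t < 0 → ∀ x,
      w t x = UnboundedOperators.heatExtension (w s) (t - s) x - oseenDuhamel 1 s w w t x :=
    fun s t _ hst ht x => hm' s t hst ht x
  have hBw : ∀ t ∈ Ioo (-3 : ℝ) 0, ∀ x, ‖w t x‖ ≤ M := fun t ht x => hM t ht.2 x
  obtain ⟨hsm, hk⟩ := hK hcw hdivw hmw hBw (-(1 / 2)) (by norm_num) (by norm_num)
  have hslice : w (-(1 / 2)) = v (-1) := by funext x; simp only [hw]; norm_num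
  rw [hslice] at hsm hk
  refine ⟨3 * K, fun y => ?_⟩
  have h2 : ContDiff ℝ 2 (v (-1)) := contDiff_infty.1 hsm 2
  exact (norm_laplacian_le_three_mul_norm_iteratedFDeriv_two h2 y).trans (by linarith [hk y])

/-! ### polynomial growth of the pressure from the rotated system -/

/-- **Affine gradient bound ⇒ quadratic growth**: `‖DP(z)‖ ≤ A + B‖z‖` for all `z` gives
`|P(y)| ≤ (|P(0)| + A + B)(1 + ‖y‖)²` (mean value inequality on the ball `‖z‖ ≤ ‖y‖`). -/
theorem abs_le_sq_of_norm_fderiv_le_affine {P : EuclideanSpace ℝ (Fin 3) → ℝ} (hP : Differentiable ℝ P) {A B : ℝ}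
    (hA : 0 ≤ A) (hB : 0 ≤ B) (hgrad : ∀ z, ‖fderiv ℝ P z‖ ≤ A + B * ‖z‖) (y : EuclideanSpace ℝ (Fin 3)) :
    |P y| ≤ (|P 0| + A + B) * (1 + ‖y‖) ^ 2 := by
  have hmv : ‖P y - P 0‖ ≤ (A + B * ‖y‖) * ‖y - 0‖ := by
    refine Convex.norm_image_sub_le_of_norm_fderiv_le (s := closedBall (0 : EuclideanSpace ℝ (Fin 3)) ‖y‖)
      (fun z _ => hP z) (fun z hz => ?_) (convex_closedBall _ _) (mem_closedBall_self (norm_nonneg _)) ?_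
    · rw [mem_closedBall, dist_zero_right] at hz
      calc ‖fderiv ℝ P z‖ ≤ A + B * ‖z‖ := hgrad z
        _ ≤ A + B * ‖y‖ := by gcongr
    · rw [mem_closedBall, dist_zero_right]
  rw [sub_zero, Real.norm_eq_abs] at hmv
  have hn := norm_nonneg y
  have e1 : |P 0| ≤ |P 0| * (1 + ‖y‖) ^ 2 := by
    have h1 : (1 : ℝ) ≤ (1 + ‖y‖) ^ 2 := by nlinarith
    nlinarith [abs_nonneg (P 0)]
  have e2 : A * ‖y‖ ≤ A * (1 + ‖y‖) ^ 2 := by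
    have h1 : ‖y‖ ≤ (1 + ‖y‖) ^ 2 := by nlinarith
    exact mul_le_mul_of_nonneg_left h1 hA
  have e3 : B * ‖y‖ * ‖y‖ ≤ B * (1 + ‖y‖) ^ 2 := by
    have h1 : ‖y‖ * ‖y‖ ≤ (1 + ‖y‖) ^ 2 := by nlinarith
    calc B * ‖y‖ * ‖y‖ = B * (‖y‖ * ‖y‖) := by ring
      _ ≤ B * (1 + ‖y‖) ^ 2 := mul_le_mul_of_nonneg_left h1 hB
  have habs : |P y| ≤ |P 0| + |P y - P 0| := by
    calc |P y| = |P 0 + (P y - P 0)| := by rw [add_sub_cancel]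
      _ ≤ |P 0| + |P y - P 0| := abs_add_le _ _
  have hexp : (A + B * ‖y‖) * ‖y‖ = A * ‖y‖ + B * ‖y‖ * ‖y‖ := by ring
  rw [hexp] at hmv
  calc |P y| ≤ |P 0| + (A * ‖y‖ + B * ‖y‖ * ‖y‖) := habs.trans (by linarith)
    _ ≤ |P 0| * (1 + ‖y‖) ^ 2 + A * (1 + ‖y‖) ^ 2 + B * (1 + ‖y‖) ^ 2 := by linarith
    _ = (|P 0| + A + B) * (1 + ‖y‖) ^ 2 := by ring

/-- **The pressure gradient of a bounded solution of the rotated Leray system is at most affine**: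
`‖∇P(z)‖ ≤ A + B‖z‖` with `A = |ν|K + (|a| + |β|)M + C₁M`, `B = (|a| + |β|)C₁` when `|U| ≤ M`, `‖DU‖ ≤ C₁`, `‖ΔU‖ ≤ K`. -/
theorem norm_fderiv_pressure_le {ν a β M C₁ K : ℝ} {U : EuclideanSpace ℝ (Fin 3) → EuclideanSpace ℝ (Fin 3)}
    {P : EuclideanSpace ℝ (Fin 3) → ℝ}
    (hpe : ∀ y, -(ν • (Δ U) y) + a • U y + a • fderiv ℝ U y y + β • (fderiv ℝ U y (rotGen y) - rotGen (U y)) +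
      convect U U y + gradient P y = 0)
    (hU : ∀ y, ‖U y‖ ≤ M) (hDU : ∀ y, ‖fderiv ℝ U y‖ ≤ C₁) (hΔU : ∀ y, ‖(Δ U) y‖ ≤ K) (z : EuclideanSpace ℝ (Fin 3)) :
    ‖fderiv ℝ P z‖ ≤ (|ν| * K + |a| * M + |β| * M + C₁ * M) + (|a| * C₁ + |β| * C₁) * ‖z‖ := by
  have hM : 0 ≤ M := (norm_nonneg _).trans (hU 0)
  have hC₁ : 0 ≤ C₁ := (norm_nonneg _).trans (hDU 0)
  have e : gradient P z = ν • (Δ U) z - a • U z - a • fderiv ℝ U z z -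
      β • (fderiv ℝ U z (rotGen z) - rotGen (U z)) - convect U U z := by
    have h := hpe z
    rw [← sub_eq_zero, ← h]
    abel
  have hn : ‖fderiv ℝ P z‖ = ‖gradient P z‖ := by
    rw [gradient, LinearIsometryEquiv.norm_map]
  have hDUw : ∀ w, ‖fderiv ℝ U z w‖ ≤ C₁ * ‖w‖ := fun w =>
    (ContinuousLinearMap.le_opNorm _ _).trans (mul_le_mul_of_nonneg_right (hDU z) (norm_nonneg w))
  have h1 : ‖ν • (Δ U) z‖ ≤ |ν| * K := by
    rw [norm_smul, Real.norm_eq_abs]; exact mul_le_mul_of_nonneg_left (hΔU z) (abs_nonneg ν)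
  have h2 : ‖a • U z‖ ≤ |a| * M := by
    rw [norm_smul, Real.norm_eq_abs]; exact mul_le_mul_of_nonneg_left (hU z) (abs_nonneg a)
  have h3 : ‖a • fderiv ℝ U z z‖ ≤ |a| * C₁ * ‖z‖ := by
    rw [norm_smul, Real.norm_eq_abs, mul_assoc]; exact mul_le_mul_of_nonneg_left (hDUw z) (abs_nonneg a)
  have h4 : ‖β • (fderiv ℝ U z (rotGen z) - rotGen (U z))‖ ≤ |β| * C₁ * ‖z‖ + |β| * M := by
    rw [norm_smul, Real.norm_eq_abs]
    have h41 : ‖fderiv ℝ U z (rotGen z)‖ ≤ C₁ * ‖z‖ :=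
      (hDUw _).trans (mul_le_mul_of_nonneg_left (norm_rotGen_le z) hC₁)
    have h42 : ‖rotGen (U z)‖ ≤ M := (norm_rotGen_le _).trans (hU z)
    have h43 : ‖fderiv ℝ U z (rotGen z) - rotGen (U z)‖ ≤ C₁ * ‖z‖ + M := (norm_sub_le _ _).trans (add_le_add h41 h42)
    calc |β| * ‖fderiv ℝ U z (rotGen z) - rotGen (U z)‖ ≤ |β| * (C₁ * ‖z‖ + M) :=
          mul_le_mul_of_nonneg_left h43 (abs_nonneg β)
      _ = |β| * C₁ * ‖z‖ + |β| * M := by ring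
  have h5 : ‖convect U U z‖ ≤ C₁ * M := by
    rw [convect_apply]
    exact (hDUw _).trans (mul_le_mul_of_nonneg_left (hU z) hC₁)
  rw [hn, e]
  have s1 := norm_sub_le (ν • (Δ U) z - a • U z - a • fderiv ℝ U z z - β • (fderiv ℝ U z (rotGen z) - rotGen (U z)))
    (convect U U z)
  have s2 := norm_sub_le (ν • (Δ U) z - a • U z - a • fderiv ℝ U z z) (β • (fderiv ℝ U z (rotGen z) - rotGen (U z)))
  have s3 := norm_sub_le (ν • (Δ U) z - a • U z) (a • fderiv ℝ U z z)
  have s4 := norm_sub_le (ν • (Δ U) z) (a • U z)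
  linarith

/-! ### the rotated Leray system at `t = −1` from the spiral invariance -/

/-- **The slice `t = −1` of a spirally invariant profile solves the rotated Leray system** (`ν = 1`, `a = ½`,
`β = κ/2`), for the pressure of the classical solution the class provides: differentiating
`e^r v(−e^{2r}, e^r R_{κr} y) = R_{κr} v(−1, y)` at `r = 0` gives `v − 2∂ₜv + Dv[y + κJy] = κJv` at `t = −1`, and
the momentum equation `∂ₜv + Dv[v] = Δv − ∇p` eliminates `∂ₜv`. -/
theorem profileEq_of_rss (hrate : HasTypeITimeDecay C v)
    (hcont : ContinuousOn (uncurry v) (Iio (0 : ℝ) ×ˢ univ))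
    (hmild : ∀ s t : ℝ, s < t → t < 0 → ∀ x,
      v t x = UnboundedOperators.heatExtension (v s) (t - s) x - oseenDuhamel 1 s v v t x)
    (hdiv : ∀ t < 0, VectorCalculus.IsDivFree (v t)) {κ : ℝ}
    (hrss : ∀ r : ℝ, ∀ s < 0, ∀ y, Real.exp r • v (Real.exp r ^ 2 * s) (Real.exp r • rotZ (κ * r) y) =
      rotZ (κ * r) (v s y)) :
    ∃ P : EuclideanSpace ℝ (Fin 3) → ℝ, ContDiff ℝ 2 P ∧ ∀ y,
      -((1 : ℝ) • (Δ (v (-1))) y) + (1 / 2 : ℝ) • v (-1) y + (1 / 2 : ℝ) • fderiv ℝ (v (-1)) y y +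
        (κ / 2) • (fderiv ℝ (v (-1)) y (rotGen y) - rotGen (v (-1) y)) +
        convect (v (-1)) (v (-1)) y + gradient P y = 0 := by
  -- the classical solution on the window `(−2, 0)`
  have hTI := isTypeIAncientMild_of_class hrate hcont hmild hdiv
  obtain ⟨p, hns⟩ := hTI.exists_isClassicalNSSolutionOn_Ioo (t₀ := -2) (by norm_num)
  have hm1 : (-1 : ℝ) ∈ Ioo (-2 : ℝ) 0 := ⟨by norm_num, by norm_num⟩
  refine ⟨p (-1), contDiff_infty.1 (hns.contDiff_pressure hm1) 2, fun y => ?_⟩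
  -- the joint derivative `L` of `uncurry v` at `(−1, y)`
  have hopen : IsOpen (Ioo (-2 : ℝ) 0 ×ˢ (univ : Set (EuclideanSpace ℝ (Fin 3)))) := isOpen_Ioo.prod isOpen_univ
  have hmem : ((-1 : ℝ), y) ∈ Ioo (-2 : ℝ) 0 ×ˢ (univ : Set (EuclideanSpace ℝ (Fin 3))) :=
    mk_mem_prod hm1 (mem_univ y)
  have hΦd : DifferentiableAt ℝ (uncurry v) ((-1 : ℝ), y) :=
    ((hns.smooth_velocity ((-1 : ℝ), y) hmem).contDiffAt (hopen.mem_nhds hmem)).differentiableAt (by simp)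
  set L := fderiv ℝ (uncurry v) ((-1 : ℝ), y) with hL
  have hΦ : HasFDerivAt (uncurry v) L ((-1 : ℝ), y) := hΦd.hasFDerivAt
  -- the slice derivative and the time derivative through `L`
  have hDv : ∀ w, fderiv ℝ (v (-1)) y w = L (0, w) := by
    intro w
    have h := (hΦ.comp y (hasFDerivAt_prodMk_right (𝕜 := ℝ) (-1 : ℝ) y)).fderiv
    have e : (uncurry v ∘ fun w : EuclideanSpace ℝ (Fin 3) => ((-1 : ℝ), w)) = v (-1) := rfl
    rw [e] at h
    rw [h, ContinuousLinearMap.comp_apply, ContinuousLinearMap.inr_apply]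
  have htime : timeDerivWithin (Ioo (-2 : ℝ) 0) v (-1) y = L (1, 0) := by
    have h := (hΦ.comp (-1 : ℝ) (hasFDerivAt_prodMk_left (𝕜 := ℝ) (-1 : ℝ) y)).hasDerivAt
    have e : (uncurry v ∘ fun s : ℝ => (s, y)) = fun s => v s y := rfl
    rw [e] at h
    rw [timeDerivWithin_apply, derivWithin_of_isOpen isOpen_Ioo hm1, h.deriv, ContinuousLinearMap.comp_apply,
      ContinuousLinearMap.inl_apply]
  -- differentiate the spiral invariance at `r = 0` on the slice `s = −1`
  have hγ₁ : HasDerivAt (fun r : ℝ => Real.exp r ^ 2 * (-1)) (-2) 0 := by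
    have h := ((Real.hasDerivAt_exp 0).pow 2).mul_const (-1 : ℝ)
    refine h.congr_deriv ?_
    simp
  have hγ₂ : HasDerivAt (fun r : ℝ => Real.exp r • rotZ (κ * r) y) (y + κ • rotGen y) 0 := by
    have h := (Real.hasDerivAt_exp 0).smul (hasDerivAt_rotZ_mul_zero κ y)
    refine h.congr_deriv ?_
    simp [rotZ_zero, add_comm]
  have hγ : HasDerivAt (fun r : ℝ => (Real.exp r ^ 2 * (-1), Real.exp r • rotZ (κ * r) y))
      ((-2 : ℝ), y + κ • rotGen y) 0 := hγ₁.prodMk hγ₂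
  have hγ0 : (Real.exp 0 ^ 2 * (-1), Real.exp 0 • rotZ (κ * 0) y) = ((-1 : ℝ), y) := by
    simp [rotZ_zero]
  have hcomp : HasDerivAt (fun r : ℝ => uncurry v (Real.exp r ^ 2 * (-1), Real.exp r • rotZ (κ * r) y))
      (L ((-2 : ℝ), y + κ • rotGen y)) 0 :=
    HasFDerivAt.comp_hasDerivAt_of_eq (x := (0 : ℝ)) hΦ hγ hγ0.symm
  have hLHS : HasDerivAt (fun r : ℝ => Real.exp r • uncurry v (Real.exp r ^ 2 * (-1), Real.exp r • rotZ (κ * r) y))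
      (Real.exp 0 • L ((-2 : ℝ), y + κ • rotGen y) +
        Real.exp 0 • uncurry v (Real.exp 0 ^ 2 * (-1), Real.exp 0 • rotZ (κ * 0) y)) 0 :=
    (Real.hasDerivAt_exp 0).smul hcomp
  have hRHS : HasDerivAt (fun r : ℝ => rotZ (κ * r) (v (-1) y)) (κ • rotGen (v (-1) y)) 0 :=
    hasDerivAt_rotZ_mul_zero κ (v (-1) y)
  have hfun : (fun r : ℝ => Real.exp r • uncurry v (Real.exp r ^ 2 * (-1), Real.exp r • rotZ (κ * r) y)) =
      fun r : ℝ => rotZ (κ * r) (v (-1) y) := funext fun r => hrss r (-1) (by norm_num) y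
  rw [hfun] at hLHS
  have hkey := hLHS.unique hRHS
  rw [hγ0, Real.exp_zero, one_smul, one_smul] at hkey
  simp only [uncurry_apply_pair] at hkey
  -- decompose `L(−2, w) = −2 L(1,0) + L(0,w)`
  have hsplit : L ((-2 : ℝ), y + κ • rotGen y) = (-2 : ℝ) • L (1, 0) + L (0, y + κ • rotGen y) := by
    have e : (((-2 : ℝ), y + κ • rotGen y) : ℝ × EuclideanSpace ℝ (Fin 3)) =
        (-2 : ℝ) • ((1 : ℝ), (0 : EuclideanSpace ℝ (Fin 3))) + ((0 : ℝ), y + κ • rotGen y) := by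
      ext <;> simp
    rw [e, map_add, map_smul]
  rw [hsplit, ← hDv, map_add, map_smul, ← htime] at hkey
  -- the momentum equation at `t = −1`
  have hmom := hns.momentum (-1) hm1 y
  simp only [Pi.zero_apply, add_zero] at hmom
  set T := timeDerivWithin (Ioo (-2 : ℝ) 0) v (-1) y with hT
  have hP : gradient (p (-1)) y = (1 : ℝ) • (Δ (v (-1))) y - T - convect (v (-1)) (v (-1)) y := by
    have h := hmom
    calc gradient (p (-1)) y
        = (T + convect (v (-1)) (v (-1)) y) + gradient (p (-1)) y - T - convect (v (-1)) (v (-1)) y := by abel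
      _ = ((1 : ℝ) • (Δ (v (-1))) y - gradient (p (-1)) y) + gradient (p (-1)) y - T -
            convect (v (-1)) (v (-1)) y := by rw [h]
      _ = (1 : ℝ) • (Δ (v (-1))) y - T - convect (v (-1)) (v (-1)) y := by abel
  rw [hP]
  have hK0 : (-2 : ℝ) • T + (fderiv ℝ (v (-1)) y y + κ • fderiv ℝ (v (-1)) y (rotGen y)) + v (-1) y -
      κ • rotGen (v (-1) y) = 0 := sub_eq_zero.2 hkey
  calc -((1 : ℝ) • (Δ (v (-1))) y) + (1 / 2 : ℝ) • v (-1) y + (1 / 2 : ℝ) • fderiv ℝ (v (-1)) y y +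
        (κ / 2) • (fderiv ℝ (v (-1)) y (rotGen y) - rotGen (v (-1) y)) + convect (v (-1)) (v (-1)) y +
        ((1 : ℝ) • (Δ (v (-1))) y - T - convect (v (-1)) (v (-1)) y)
      = (1 / 2 : ℝ) • ((-2 : ℝ) • T + (fderiv ℝ (v (-1)) y y + κ • fderiv ℝ (v (-1)) y (rotGen y)) + v (-1) y -
          κ • rotGen (v (-1) y)) := by module
    _ = 0 := by rw [hK0, smul_zero]

/-! ### the stratum -/

/-- **ROTATING SELF-SIMILARITY ABOUT A VERTICAL AXIS, SLOW ROTATION: EMPTY.**  A profile of the route's Type-I class,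
poloidal along `e₃` on every slice, invariant under the spiral subgroup
`e^r v(e^{2r}s, e^r R_{κr} y) = R_{κr} v(s,y)` (`R = rotZ`, all `r`, `s < 0`, `y`) with `|κ| < 1`, vanishes identically. -/
theorem eq_zero_of_spiralSelfSimilar_vertical (hrate : HasTypeITimeDecay C v)
    (hcont : ContinuousOn (uncurry v) (Iio (0 : ℝ) ×ˢ univ))
    (hmild : ∀ s t : ℝ, s < t → t < 0 → ∀ x,
      v t x = UnboundedOperators.heatExtension (v s) (t - s) x - oseenDuhamel 1 s v v t x)
    (hdiv : ∀ t < 0, VectorCalculus.IsDivFree (v t))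
    (hpol : ∀ s < 0, ∀ y, ⟪curl (v s) y, EuclideanSpace.single 2 1⟫_ℝ = 0) {κ : ℝ} (hκ : |κ| < 1)
    (hrss : ∀ r : ℝ, ∀ s < 0, ∀ y, Real.exp r • v (Real.exp r ^ 2 * s) (Real.exp r • rotZ (κ * r) y) =
      rotZ (κ * r) (v s y)) :
    ∀ t < 0, ∀ x, v t x = 0 := by
  have hbdd := bdd_of_hasTypeITimeDecay hrate
  have hneg1 : (-1 : ℝ) < 0 := by norm_num
  obtain ⟨P, hP2, hpe⟩ := profileEq_of_rss hrate hcont hmild hdiv hrss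
  -- data of the slice `U = v(−1)`
  have hU3 : ContDiff ℝ 3 (v (-1)) := (analyticOnNhd_slice hcont hbdd hmild hneg1).contDiff
  have hpol1 : ∀ y, curl (v (-1)) y 2 = 0 := fun y => by
    have h1 := hpol (-1) hneg1 y
    rwa [EuclideanSpace.inner_single_right, one_mul, conj_trivial] at h1
  have hUbdd : ∀ y, ‖v (-1) y‖ ≤ C := fun y => by
    have h := hrate (-1) hneg1 y
    rwa [neg_neg, Real.sqrt_one, div_one] at h
  obtain ⟨C₁, hC₁⟩ := exists_fderiv_rate_of_class hrate hcont hmild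
  have hDU : ∀ y, ‖fderiv ℝ (v (-1)) y‖ ≤ C₁ := fun y => by
    have h := hC₁ (-1) hneg1 y
    rwa [neg_neg, div_one] at h
  obtain ⟨K, hK⟩ := exists_laplacian_bound hrate hcont hmild hdiv
  -- polynomial growth of the pressure
  have hM : 0 ≤ C := (norm_nonneg _).trans (hUbdd 0)
  have hC₁0 : 0 ≤ C₁ := (norm_nonneg _).trans (hDU 0)
  have hK0 : 0 ≤ K := (norm_nonneg _).trans (hK 0)
  have hgrad := norm_fderiv_pressure_le hpe hUbdd hDU hK
  have hA : 0 ≤ |(1 : ℝ)| * K + |(1 / 2 : ℝ)| * C + |κ / 2| * C + C₁ * C := by positivity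
  have hB : 0 ≤ |(1 / 2 : ℝ)| * C₁ + |κ / 2| * C₁ := by positivity
  have hPpoly := abs_le_sq_of_norm_fderiv_le_affine (hP2.differentiable (by norm_num)) hA hB hgrad
  -- the rotated Leray Liouville theorem: the slice is constant
  have hκ2 : |κ / 2| < 1 / 2 := by rw [abs_div, abs_two]; linarith
  have hconst : ∀ x y, v (-1) x = v (-1) y :=
    rotatedLeray_const_of_poloidal one_pos (by norm_num) hκ2 hU3 hP2 hpe (hdiv (-1) hneg1) hpol1 hUbdd hPpoly
  -- a constant slice is translation-invariant: the planar Liouville stratum ends the proof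
  have hne : (EuclideanSpace.single 0 1 : EuclideanSpace ℝ (Fin 3)) ≠ 0 := fun h0 => by
    simpa using congrArg (fun w : EuclideanSpace ℝ (Fin 3) => w 0) h0
  exact eq_zero_of_translate_eq_slice hrate hcont hmild hdiv hneg1 hne fun y l => hconst _ _

/-- **The slowly rotating vertical-axis RSS stratum is empty**: such a profile is not backward-singular. -/
theorem nonflatLiouville_of_spiralSelfSimilar_vertical (hrate : HasTypeITimeDecay C v)
    (hcont : ContinuousOn (uncurry v) (Iio (0 : ℝ) ×ˢ univ))
    (hmild : ∀ s t : ℝ, s < t → t < 0 → ∀ x,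
      v t x = UnboundedOperators.heatExtension (v s) (t - s) x - oseenDuhamel 1 s v v t x)
    (hdiv : ∀ t < 0, VectorCalculus.IsDivFree (v t))
    (hpol : ∀ s < 0, ∀ y, ⟪curl (v s) y, EuclideanSpace.single 2 1⟫_ℝ = 0) {κ : ℝ} (hκ : |κ| < 1)
    (hrss : ∀ r : ℝ, ∀ s < 0, ∀ y, Real.exp r • v (Real.exp r ^ 2 * s) (Real.exp r • rotZ (κ * r) y) =
      rotZ (κ * r) (v s y)) :
    ¬ IsBackwardSingularPoint v 0 :=
  Summit.NavierStokesRegularity.NavierStokesRegularity.Theorems.PoloidalWindowDoorPoloidalWindowRigidityFlat.not_backwardSingular_of_zero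
    (eq_zero_of_spiralSelfSimilar_vertical hrate hcont hmild hdiv hpol hκ hrss)

end Summit.NavierStokesRegularity.NavierStokesRegularity.Theorems.PoloidalWindowDoorPoloidalWindowRigiditySpiralSelfSimilar

end
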